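import Summits.CriticalPhenomena.PercolationContinuityZ3.Theorems.PercNearOneGluingNoHeavyLowerTailSunflowerBipartitePolarisation
import HarnessLib

/-!
# `NoHeavyLowerTail` (crux stmt-CriticalPhenomena-4575), abstract sunflower cubic: BIPARTITE GRAPH CORES ARE A-SAFE — part 2: SYMMETRISATION over `Equiv.Perm (Fin K)`

Support file (seat `prim-ineq-prove-1` gen 40; `--supports stmt-CriticalPhenomena-4575`).  No `sorry`, no named facts.  Memo:
run/shared/lean/prim/prim-ineq-prove-1/FINDING-BIPARTITE-prove1-g40.md (§1 polarisation, §2 symmetrisation, §3 conditioning, §4 the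
type-model lemma = `TypeModel.Model.typeModel_lemma` of `…SunflowerTypeModelLemma`).

THE THEOREM (file `…SunflowerBipartiteSafe`, `Bridge.safe_edgeCore_of_bipartite`): **every bipartite graph core is safe for every
parameter vector** — if `L` is one side of a bipartition of `Γ : SimpleGraph (Fin n)` then `SafeCalc.Safe p (SafeCalc.edgeCore Γ)` for all
`p`, i.e. Lemma A `∏_k μ_p(V k) ≤ μ_p(A)^(K−1)` for every number `K` of petals (g39's conjecture `TriangleFreeSafe` on the bipartite
stratum: all trees, even cycles, grids, cubes, `K_{a,b}` minus anything, …).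

THIS FILE (§2 of the memo).  `J A S` (independent rows), global `BadG`/`GoodG`, the relabelling action `act σ S` with
`card_filter_rows_eq` (the fibrewise count `N_V` is invariant under relabelling the petals), the permutation counts
`factorial_le_card_perm_apply_eq` (`#{σ | σ k = j} ≥ (K−1)!`) and `card_perm_eqOn_le` (`#{σ | σ|_J prescribed} ≤ (K−|J|)!`, via
`permsOfFinset`), and the main double count **`polarised_of_weighted`**: the weighted inequality
`Σ_{BadG} (K−|J|)! ≤ (K−1)!·#GoodG` on a profile fibre implies the polarised inequality (★)
`#{S | ∀ k, row S k ∈ A ∪ W k} ≤ #{S | ∀ k ≠ last, row S k ∈ A}` on that fibre.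
-/

namespace Summit.CriticalPhenomena.PercolationContinuityZ3.Theorems.SunflowerPartition

namespace Bridge

open Finset MeasureTheory Literature.Probability.LatticeModels Literature.Probability.Percolation

variable {K n : ℕ}

/-! ### G2: symmetrisation over `Equiv.Perm (Fin K)` -/

section Symm

variable (A : Set (Set (Fin n))) (W : Fin K → Set (Set (Fin n)))

/-- The independent ("non-A") rows of a configuration. -/
noncomputable def J (S : Fin n → Finset (Fin K)) : Finset (Fin K) := by
  classical exact univ.filter fun k => row S k ∉ A

/-- Global BAD: at least two non-A rows, lying in pairwise distinct petals (none outside the petals). -/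
def BadG (S : Fin n → Finset (Fin K)) : Prop :=
  2 ≤ (J A S).card ∧ ∃ f : Fin K → Fin K, Set.InjOn f ↑(J A S) ∧ ∀ k ∈ J A S, row S k ∈ W (f k)

/-- Global GOOD: exactly one non-A row, lying in no petal. -/
def GoodG (S : Fin n → Finset (Fin K)) : Prop :=
  ∃ k, J A S = {k} ∧ ∀ j, row S k ∉ W j

/-- The relabelling action of `σ` on slot-set assignments. -/
def act (σ : Equiv.Perm (Fin K)) (S : Fin n → Finset (Fin K)) : Fin n → Finset (Fin K) :=
  fun x => (S x).map σ.toEmbedding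

/-- Rows of a relabelled assignment: `row (σ • S) j = row S (σ⁻¹ j)`. [this work] -/
theorem row_act (σ : Equiv.Perm (Fin K)) (S : Fin n → Finset (Fin K)) (j : Fin K) :
    row (act σ S) j = row S (σ.symm j) := by
  ext x; simp [row, act, Finset.mem_map_equiv]

/-- Relabelling preserves the profile. [this work] -/
theorem act_mem_confs {m : Fin n → ℕ} {σ : Equiv.Perm (Fin K)} {S : Fin n → Finset (Fin K)}
    (h : S ∈ TypeModel.Model.confs m) : act σ S ∈ TypeModel.Model.confs m := by
  rw [TypeModel.Model.mem_confs] at h ⊢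
  intro x; rw [← h x]; exact Finset.card_map _

/-- `σ⁻¹ • (σ • S) = S`. [this work] -/
theorem act_symm_act (σ : Equiv.Perm (Fin K)) (S : Fin n → Finset (Fin K)) : act σ.symm (act σ S) = S := by
  funext x; unfold act; rw [Finset.map_map]; convert Finset.map_refl using 2
  ext k; simp

/-- `σ • (σ⁻¹ • S) = S`. [this work] -/
theorem act_act_symm (σ : Equiv.Perm (Fin K)) (S : Fin n → Finset (Fin K)) : act σ (act σ.symm S) = S := by
  simpa using act_symm_act σ.symm S

/-- Relabelling invariance of the fibrewise count: `N_V = N_{V ∘ σ}`. -/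
theorem card_filter_rows_eq (m : Fin n → ℕ) (V : Fin K → Set (Set (Fin n))) (σ : Equiv.Perm (Fin K))
    [DecidablePred fun S : Fin n → Finset (Fin K) => ∀ k, row S k ∈ V k]
    [DecidablePred fun S : Fin n → Finset (Fin K) => ∀ k, row S k ∈ V (σ k)] :
    ((TypeModel.Model.confs m).filter fun S => ∀ k, row S k ∈ V (σ k)).card =
      ((TypeModel.Model.confs m).filter fun S => ∀ k, row S k ∈ V k).card := by
  refine Finset.card_bij (fun S _ => act σ S) ?_ ?_ ?_
  · intro S hS
    rw [Finset.mem_filter] at hS ⊢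
    refine ⟨act_mem_confs hS.1, fun j => ?_⟩
    rw [row_act]
    have := hS.2 (σ.symm j); rwa [Equiv.apply_symm_apply] at this
  · intro S₁ _ S₂ _ h
    have := congrArg (act σ.symm) h
    rwa [act_symm_act, act_symm_act] at this
  · intro S' hS'
    rw [Finset.mem_filter] at hS'
    refine ⟨act σ.symm S', ?_, act_act_symm σ S'⟩
    rw [Finset.mem_filter]
    refine ⟨act_mem_confs hS'.1, fun k => ?_⟩
    rw [row_act]; simpa using hS'.2 (σ k)

/-- Permutations with one prescribed value: at least `(K-1)!` of them. -/
theorem factorial_le_card_perm_apply_eq (k j : Fin K) :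
    (K - 1).factorial ≤ ((univ : Finset (Equiv.Perm (Fin K))).filter fun σ => σ k = j).card := by
  classical
  have hc : (univ.erase k).card = K - 1 := by
    rw [Finset.card_erase_of_mem (Finset.mem_univ _), Finset.card_univ, Fintype.card_fin]
  rw [← hc, ← card_perms_of_finset]
  refine Finset.card_le_card_of_injOn (fun τ => Equiv.swap k j * τ) ?_ ?_
  · intro τ hτ
    rw [Finset.mem_coe, mem_perms_of_finset_iff] at hτ
    simp only [Finset.coe_filter, Finset.mem_univ, true_and, Set.mem_setOf_eq, Equiv.Perm.mul_apply]
    have : τ k = k := by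
      by_contra h; exact (Finset.mem_erase.1 (hτ h)).1 rfl
    rw [this, Equiv.swap_apply_left]
  · intro τ _ τ' _ h; exact mul_left_cancel h

/-- Permutations with prescribed values on `Jset`: at most `(K - |Jset|)!` of them. -/
theorem card_perm_eqOn_le (Jset : Finset (Fin K)) (f : Fin K → Fin K) :
    ((univ : Finset (Equiv.Perm (Fin K))).filter fun σ => ∀ k ∈ Jset, σ k = f k).card ≤ (K - Jset.card).factorial := by
  classical
  set T := (univ : Finset (Equiv.Perm (Fin K))).filter fun σ => ∀ k ∈ Jset, σ k = f k with hT
  rcases T.eq_empty_or_nonempty with h0 | ⟨σ₀, hσ₀⟩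
  · rw [h0, Finset.card_empty]; exact Nat.zero_le _
  have hc : (univ \ Jset).card = K - Jset.card := by
    rw [Finset.card_sdiff_of_subset (Finset.subset_univ _), Finset.card_univ, Fintype.card_fin]
  rw [← hc, ← card_perms_of_finset]
  refine Finset.card_le_card_of_injOn (fun σ => σ₀⁻¹ * σ) ?_ ?_
  · intro σ hσ
    have hσ' : ∀ k ∈ Jset, σ k = f k := (Finset.mem_filter.1 (Finset.mem_coe.1 hσ)).2
    have hσ₀' : ∀ k ∈ Jset, σ₀ k = f k := (Finset.mem_filter.1 hσ₀).2
    rw [Finset.mem_coe, mem_perms_of_finset_iff]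
    intro x hx
    rw [Finset.mem_sdiff]
    refine ⟨Finset.mem_univ _, fun hxJ => hx ?_⟩
    rw [Equiv.Perm.mul_apply, hσ' x hxJ, ← hσ₀' x hxJ]
    simp
  · intro σ _ σ' _ h; exact mul_left_cancel h

end Symm

/-! #### The main symmetrisation theorem -/

section SymmMain

variable {A : Set (Set (Fin n))} {W : Fin K → Set (Set (Fin n))}

/-- Petals are disjoint from the core and from each other. -/
structure PetalData (A : Set (Set (Fin n))) (W : Fin K → Set (Set (Fin n))) : Prop where
  disjA : ∀ k ω, ω ∈ W k → ω ∉ A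
  disj : ∀ k l ω, ω ∈ W k → ω ∈ W l → k = l

/-- Membership in `J`: the independent rows. [this work] -/
theorem mem_J {S : Fin n → Finset (Fin K)} {k : Fin K} : k ∈ J A S ↔ row S k ∉ A := by
  classical
  unfold J; simp

open scoped Classical in
/-- **G2 (SYMMETRISATION).**  The weighted inequality `Σ_{BAD} (K − |J|)! ≤ (K−1)!·#GOOD` for the profile `m` implies the
polarised inequality (★) `#{S ∈ confs m | ∀ k, row S k ∈ A ∪ W k} ≤ #{S ∈ confs m | ∀ k ≠ last, row S k ∈ A}`. [this work] -/
theorem polarised_of_weighted (hW : PetalData A W) (m : Fin n → ℕ) (last : Fin K)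
    (hw : ∑ S ∈ (TypeModel.Model.confs m).filter (fun S => BadG A W S), (K - (J A S).card).factorial ≤
      (K - 1).factorial * ((TypeModel.Model.confs m).filter fun S => GoodG A W S).card) :
    ((TypeModel.Model.confs m).filter fun S => ∀ k, row S k ∈ A ∪ W k).card ≤
      ((TypeModel.Model.confs m).filter fun S => ∀ k, k ≠ last → row S k ∈ A).card := by
  classical
  set C := TypeModel.Model.confs (ι := Fin n) (K := K) m with hC
  set PERM := (univ : Finset (Equiv.Perm (Fin K))) with hPERM
  -- the two per-configuration counts
  set cntV : (Fin n → Finset (Fin K)) → ℕ := fun S => (PERM.filter fun σ => ∀ k, row S k ∈ A ∪ W (σ k)).card with hcntV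
  set cntA : (Fin n → Finset (Fin K)) → ℕ := fun S => (PERM.filter fun σ => ∀ k, σ k ≠ last → row S k ∈ A).card with hcntA
  -- Step 1: K! · LHS = Σ_S cntV S  and  K! · RHS = Σ_S cntA S
  have lhs_eq : PERM.card * (C.filter fun S => ∀ k, row S k ∈ A ∪ W k).card = ∑ S ∈ C, cntV S := by
    calc PERM.card * (C.filter fun S => ∀ k, row S k ∈ A ∪ W k).card
        = ∑ σ ∈ PERM, (C.filter fun S => ∀ k, row S k ∈ A ∪ W k).card := by rw [Finset.sum_const, smul_eq_mul]
      _ = ∑ σ ∈ PERM, (C.filter fun S => ∀ k, row S k ∈ A ∪ W (σ k)).card :=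
          Finset.sum_congr rfl fun σ _ => by convert (card_filter_rows_eq m (fun k => A ∪ W k) σ).symm using 2
      _ = ∑ S ∈ C, cntV S := by
          simp only [hcntV, Finset.card_filter]
          exact Finset.sum_comm
  have rhs_eq : PERM.card * (C.filter fun S => ∀ k, k ≠ last → row S k ∈ A).card = ∑ S ∈ C, cntA S := by
    have step : ∀ σ : Equiv.Perm (Fin K), (C.filter fun S => ∀ k, k ≠ last → row S k ∈ A).card =
        (C.filter fun S => ∀ k, σ k ≠ last → row S k ∈ A).card := by
      intro σ
      have h := card_filter_rows_eq m (fun k => if k = last then (Set.univ : Set (Set (Fin n))) else A) σ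
      have e1 : (C.filter fun S => ∀ k, row S k ∈ (fun k => if k = last then (Set.univ : Set (Set (Fin n))) else A) (σ k)) =
          C.filter fun S => ∀ k, σ k ≠ last → row S k ∈ A := by
        refine Finset.filter_congr fun S _ => ?_
        refine forall_congr' fun k => ?_
        by_cases hk : σ k = last <;> simp [hk]
      have e2 : (C.filter fun S => ∀ k, row S k ∈ (fun k => if k = last then (Set.univ : Set (Set (Fin n))) else A) k) =
          C.filter fun S => ∀ k, k ≠ last → row S k ∈ A := by
        refine Finset.filter_congr fun S _ => ?_
        refine forall_congr' fun k => ?_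
        by_cases hk : k = last <;> simp [hk]
      rw [e1, e2] at h
      convert h.symm using 2
    calc PERM.card * (C.filter fun S => ∀ k, k ≠ last → row S k ∈ A).card
        = ∑ σ ∈ PERM, (C.filter fun S => ∀ k, k ≠ last → row S k ∈ A).card := by rw [Finset.sum_const, smul_eq_mul]
      _ = ∑ σ ∈ PERM, (C.filter fun S => ∀ k, σ k ≠ last → row S k ∈ A).card := Finset.sum_congr rfl fun σ _ => step σ
      _ = ∑ S ∈ C, cntA S := by
          simp only [hcntA, Finset.card_filter]
          exact Finset.sum_comm
  -- Step 2: termwise comparison with a correction paid by `hw`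
  have hPERMpos : 0 < PERM.card := Finset.card_pos.2 ⟨1, Finset.mem_univ _⟩
  suffices hmain : ∑ S ∈ C, cntV S ≤ ∑ S ∈ C, cntA S by
    have := lhs_eq ▸ rhs_eq ▸ hmain
    exact Nat.le_of_mul_le_mul_left this hPERMpos
  -- per-configuration bounds
  have bound : ∀ S ∈ C, cntV S + (if GoodG A W S then (K - 1).factorial else 0) ≤
      cntA S + (if BadG A W S then (K - (J A S).card).factorial else 0) := by
    intro S hS
    -- auxiliary facts
    have cntA_univ : (J A S) = ∅ → cntA S = PERM.card := by
      intro hJ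
      show (PERM.filter fun σ => ∀ k, σ k ≠ last → row S k ∈ A).card = PERM.card
      congr 1
      refine Finset.filter_true_of_mem fun σ _ k _ => ?_
      by_contra h; have : k ∈ J A S := mem_J.2 h; rw [hJ] at this; simp at this
    have cntV_le : cntV S ≤ PERM.card := Finset.card_filter_le _ _
    by_cases hJ0 : J A S = ∅
    · -- all rows in A
      have hng : ¬ GoodG A W S := by rintro ⟨k, hk, -⟩; rw [hJ0] at hk; simp at hk
      have hnb : ¬ BadG A W S := by rintro ⟨h2, -⟩; rw [hJ0] at h2; simp at h2
      rw [if_neg hng, if_neg hnb, cntA_univ hJ0]; simpa using cntV_le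
    by_cases hJ1 : (J A S).card = 1
    · obtain ⟨k, hk⟩ := Finset.card_eq_one.1 hJ1
      have hnb : ¬ BadG A W S := by rintro ⟨h2, -⟩; rw [hJ1] at h2; omega
      rw [if_neg hnb, add_zero]
      have hrowk : row S k ∉ A := mem_J.1 (hk ▸ Finset.mem_singleton_self k)
      have hother : ∀ j, j ≠ k → row S j ∈ A := by
        intro j hj; by_contra h; have := mem_J.2 h; rw [hk, Finset.mem_singleton] at this; exact hj this
      -- cntA S ≥ #{σ : σ k = last} ≥ (K-1)!
      have hA1 : (K - 1).factorial ≤ cntA S := by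
        refine (factorial_le_card_perm_apply_eq k last).trans (Finset.card_le_card ?_)
        intro σ hσ
        rw [Finset.mem_filter] at hσ ⊢
        refine ⟨hσ.1, fun j hj => hother j ?_⟩
        rintro rfl; exact hj hσ.2
      by_cases hg : GoodG A W S
      · -- cntV S = 0
        have hV0 : cntV S = 0 := by
          show (PERM.filter fun σ => ∀ k, row S k ∈ A ∪ W (σ k)).card = 0
          rw [Finset.card_eq_zero, Finset.filter_eq_empty_iff]
          intro σ _ hall
          obtain ⟨k', hk', hnone⟩ := hg
          rcases hall k' with h | h
          · exact (mem_J.1 (hk' ▸ Finset.mem_singleton_self k')) h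
          · exact hnone _ h
        rw [hV0, if_pos hg, zero_add]; exact hA1
      · rw [if_neg hg, add_zero]
        -- row k lies in some petal p (else S would be GOOD)
        have hp : ∃ p, row S k ∈ W p := by
          by_contra h; push Not at h; exact hg ⟨k, hk, h⟩
        obtain ⟨p, hp⟩ := hp
        calc cntV S ≤ (PERM.filter fun σ => σ k = p).card := by
              refine Finset.card_le_card fun σ hσ => ?_
              rw [Finset.mem_filter] at hσ ⊢
              refine ⟨hσ.1, ?_⟩
              rcases hσ.2 k with h | h
              · exact absurd h hrowk
              · exact (hW.disj _ _ _ h hp)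
          _ ≤ (PERM.filter fun σ => σ k = last).card := by
              refine Finset.card_le_card_of_injOn (fun σ => Equiv.swap p last * σ) ?_ ?_
              · intro σ hσ
                rw [Finset.mem_coe, Finset.mem_filter] at hσ ⊢
                refine ⟨Finset.mem_univ _, ?_⟩
                rw [Equiv.Perm.mul_apply, hσ.2, Equiv.swap_apply_left]
              · intro σ _ σ' _ h; exact mul_left_cancel h
          _ ≤ cntA S := by
              refine Finset.card_le_card fun σ hσ => ?_
              rw [Finset.mem_filter] at hσ ⊢
              refine ⟨hσ.1, fun j hj => hother j ?_⟩
              rintro rfl; exact hj hσ.2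
    · -- |J| ≥ 2 : not GOOD; cntV ≤ (K-|J|)! if BAD, = 0 otherwise
      have h2 : 2 ≤ (J A S).card := by
        have := Finset.card_pos.2 (Finset.nonempty_iff_ne_empty.2 hJ0); omega
      have hng : ¬ GoodG A W S := by rintro ⟨k, hk', -⟩; rw [hk', Finset.card_singleton] at hJ1; exact hJ1 rfl
      rw [if_neg hng, add_zero]
      by_cases hb : BadG A W S
      · rw [if_pos hb]
        obtain ⟨-, f, hfinj, hf⟩ := hb
        calc cntV S ≤ (PERM.filter fun σ => ∀ k ∈ J A S, σ k = f k).card := by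
              refine Finset.card_le_card fun σ hσ => ?_
              rw [Finset.mem_filter] at hσ ⊢
              refine ⟨hσ.1, fun k hkJ => ?_⟩
              rcases hσ.2 k with h | h
              · exact absurd h (mem_J.1 hkJ)
              · exact hW.disj _ _ _ h (hf k hkJ)
          _ ≤ (K - (J A S).card).factorial := card_perm_eqOn_le _ _
          _ ≤ cntA S + (K - (J A S).card).factorial := Nat.le_add_left _ _
      · rw [if_neg hb]
        have hV0 : cntV S = 0 := by
          show (PERM.filter fun σ => ∀ k, row S k ∈ A ∪ W (σ k)).card = 0
          rw [Finset.card_eq_zero, Finset.filter_eq_empty_iff]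
          intro σ _ hall
          apply hb
          refine ⟨h2, σ, σ.injective.injOn, fun k hkJ => ?_⟩
          rcases hall k with h | h
          · exact absurd h (mem_J.1 hkJ)
          · exact h
        rw [hV0]; exact Nat.zero_le _
  -- Step 3: sum the bounds
  have hsum := Finset.sum_le_sum bound
  rw [Finset.sum_add_distrib, Finset.sum_add_distrib] at hsum
  have e1 : ∑ S ∈ C, (if GoodG A W S then (K - 1).factorial else 0) = (K - 1).factorial * (C.filter fun S => GoodG A W S).card := by
    rw [← Finset.sum_filter, Finset.sum_const, smul_eq_mul, mul_comm]
  have e2 : ∑ S ∈ C, (if BadG A W S then (K - (J A S).card).factorial else 0) =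
      ∑ S ∈ C.filter (fun S => BadG A W S), (K - (J A S).card).factorial := by
    rw [← Finset.sum_filter]
  rw [e1, e2] at hsum
  omega

end SymmMain


end Bridge

end Summit.CriticalPhenomena.PercolationContinuityZ3.Theorems.SunflowerPartition
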